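import Literature.Geometry.Kaehler.ComplexTorusAbelianSurfaceQuaternionMultiplicationHodgeEqLefschetz
import Literature.Geometry.Kaehler.ComplexTorusHodgeLieAlgebraAbelianSurfacesSixTypes
import Literature.Geometry.Kaehler.ComplexTorusHodgeGroupLieAlgebraAlgebraic
import Literature.Geometry.Kaehler.ComplexTorusHodgeLieAlgebraSymplecticDimension
import HarnessLib

/-!
# Moonen–Zarhin 1999 (2.2), Type II(1): `dim Hg(X) = dim_ℂ 𝔤 = dim_ℂ 𝔩𝔣_ℂ = dim_ℝ 𝔥𝔤_ℝ = 3` and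
# `(dim 𝔨, dim 𝔭) = (1, 2)` for a SIMPLE polarised abelian SURFACE with QUATERNION MULTIPLICATION
# (`Hg(X) = U_{D^opp}`, a `ℚ`-form of `SL₂`; Sato–Tate type **E** ↔ `SU(2)`)

Layer `Literature/Geometry/Kaehler`, namespace `Literature.Geometry.Kaehler.ComplexTorus`; lane `lit-hodgefound`
(Track 2 foundations library), Layer A4; prover seat `lit-hodgefound-p17` (generation 48), self-proposed row g48-#4 —
the DIMENSION rider of g48-#1 (`ComplexTorusAbelianSurfaceQuaternionMultiplicationHodgeEqLefschetz`: for a simple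
polarised abelian surface of Albert type II, `𝔤 = Lie Hg(X)(ℂ)` equals `𝔩𝔣_ℂ = Lie S(X)(ℂ)` and acts irreducibly on the
plane `U = e₀₀ V_ℂ` cut out by a system of matrix units `e a b` of `End⁰(X) ⊗ ℂ ≅ M₂(ℂ)`).  Here the restriction
`Z ↦ Z|U` is shown to be a LINEAR ISOMORPHISM `𝔤 ⥲ 𝔰𝔩(U)`: injective because every `Z ∈ 𝔤` commutes with `e₁₀`
(g48-#1 `eq_of_matrixUnits_of_forall_mulVec_eq`), into `𝔰𝔩(U)` because `Z` is `E`-skew and `e₀₀` is `E`-self-adjoint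
(g48-#1 `trace_restrict_eq_zero_of_matrixUnits`), onto `𝔰𝔩(U)` by Lie's theorem on the `𝔤`-irreducible plane `U`
(g47-#5 `exists_mem_forall_eq_of_trace_eq_zero`); hence `dim_ℂ 𝔤 = dim 𝔰𝔩₂ = 3` (g47-#5 `finrank_ker_trace_eq_three`),
and the tree's dictionaries turn this into `dim_ℂ 𝔩𝔣_ℂ = 3`, `dim_ℝ 𝔥𝔤_ℝ = 3`, `dim Hg(X) = 3` (the trunk's `zdim`),
`(dim 𝔨, dim 𝔭) = (1, 2)` (g20's table of abelian surfaces) and `Hg(X) ≠ Sp(V, E)`.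

THEOREMS ONLY (no definition, no instance, no notation, no named fact; D-0026, net debt 0).  The twin at the level of
`AbelianVariety ∕ bettiRep` (`Literature/AlgebraicGeometry/HodgeTheory`) is not restated; p12's
`ComplexTorusQuaternionHodgeGroupEquality` treats the explicit family `A(τ)` only.

## Sources, VERBATIM (held copies; `p0NNN Lnn` = chunk file and line of the materialised text)

* B. Moonen, Yu. G. Zarhin, *Hodge classes on abelian varieties of low dimension*, Math. Ann. 315 (1999) 711–733, held
  `paper:arxiv-math_9901113` (the held TeX carries no statement numbers; «(2.2)» is the `g = 2` list of §2): §2 (2.2),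
  `g = 2` (p0005 L69–L73) «Type II(1): `D = End⁰(X)` is a quaternion algebra over `ℚ`, split at `∞`. Write `D^opp` for
  the opposite algebra, and let `x ↦ x*` be the canonical involution. Then `Hg(X)` is the algebraic group `U_{D^opp}`
  given on points by `U_{D^opp}(ℚ) = {x ∈ (D^opp)* ∣ x x* = 1}`» (over `ℂ`: `D^opp ⊗ ℂ ≅ M₂(ℂ)` and `x x* = 1` is
  `det x = 1`, so `U_{D^opp}(ℂ) ≅ SL₂(ℂ)`, of dimension `3`); §3, proof of Lemma (3.3) (p0006 L94–L100; arXiv v2 = Math. Ann. numbering — earlier tree copies of this family wrote «(3.5)», which is Borovoi’s Remark) «We have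
  `D ⊗_ℚ ℂ ≅ M_d(ℂ)_{(1)} × ⋯ × M_d(ℂ)_{(e)}`. There are irreducible `𝔥𝔤(X)_ℂ`-modules `U_1, …, U_e` […] such that
  `V_X ⊗_ℚ ℂ ≅ U_1^d ⊕ ⋯ ⊕ U_e^d` […] `𝔥𝔤(X)_ℂ` acts on each of the summands `U_j^d` through `𝔰𝔩(U_j^d)`».
* J. S. Milne, *Lefschetz classes on abelian varieties*, Duke Math. J. 96 (1999) 639–675, held
  `paper:doi-10-1215-s0012-7094-99-09620-5`, §2 «Simple abelian variety of type II» (p0012 L33–L36) «`γ ↦ γ|V_{σ₁}`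
  identifies `U(φ_{1,σ}) ∩ Sp(φ_{2,σ})` with `Sp(φ_{2,σ₁})`. The representation of `Sp(φ_{2,σ₁})` on `V_{σ₁}` is its
  standard representation» (here `e = 1`, `V_{σ₁} = U` a plane, `Sp(φ_{2,σ₁}) = Sp₂ = SL₂`).
* F. Fité, K. S. Kedlaya, V. Rotger, A. V. Sutherland, *Sato–Tate distributions and Galois endomorphism modules in genus 2*,
  Compositio Math. 148 (2012), held `paper:arxiv-1110.6638`, §4.2 (p0014 L65–L70) «(**E**) `M₂(ℝ)`, which occurs when either
  `A_K` is isogenous to the square of an elliptic curve without CM, or `A_K` is simple and `End(A_K)` is an order in a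
  division quaternion algebra over `ℚ`», (p0014 L78–L82) «The six absolute types are in one-to-one correspondence with the
  six connected Lie subgroups of `USp(4)` appearing in Lemma […] **E**: `SU(2)`»; §3.2 Lemma 3.7 (the six groups
  `U(1), SU(2), U(1) × U(1), U(1) × SU(2), SU(2) × SU(2), USp(4)`).  `SU(2)` is the compact form of `Hg(X)_ℝ ≅ SL₂(ℝ)`:
  `dim_ℝ 𝔥𝔤_ℝ = 3`, `𝔥𝔤_ℝ = 𝔨 ⊕ 𝔭 = 𝔰𝔬(2) ⊕ 𝔭` with `(dim 𝔨, dim 𝔭) = (1, 2)`.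
* J. E. Humphreys, *Introduction to Lie Algebras and Representation Theory* (1972), §1.2 (`A_ℓ`: `dim 𝔰𝔩(ℓ+1, F) =
  (ℓ+1)² - 1`; `C_ℓ`: `𝔰𝔭(2ℓ, F)`, for `ℓ = 1` equal to `𝔰𝔩(2, F)`), §4.1 (Lie's theorem).
* R. Goodman, N. R. Wallach, *Symmetry, Representations, and Invariants*, GTM 255, §1.4.4 Thm. 1.4.10 (the Lie algebra of
  an algebraic group and its dimension; consumed through `finrank_hodgeGroupLie_eq_zdim`).

## Contents

* §1 ENGINE (any algebraically closed field of characteristic `0`): **`finrank_eq_three_of_matrixUnits`** — a subspace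
  `S ⊆ M_κ(R)` closed under `ZW - WZ`, commuting with a system of `2 × 2` matrix units `e a b` (`e₀₀ + e₁₁ = 1`),
  `E`-skew for an invertible alternating `E` with `e₀₀` `E`-self-adjoint, and acting irreducibly on the plane `U = e₀₀V`,
  has dimension `3` (restriction to `U` is an isomorphism onto `𝔰𝔩(U)`).
* §2 TYPE II(1): **`IsSimple.finrank_hodgeGroupComplexLie_eq_three_of_isAlbertTypeII_of_finrank_eq_two`** (`dim_ℂ 𝔤 = 3`),
  `IsSimple.finrank_lefschetzLieC_eq_three_…` (`dim_ℂ 𝔩𝔣_ℂ = 3`), `IsSimple.finrank_hodgeGroupLie_eq_three_…`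
  (`dim_ℝ 𝔥𝔤_ℝ = 3`), `IsSimple.zdim_hodgeGroupC_eq_three_…` (`dim Hg(X) = 3`),
  `IsSimple.finrank_hodgeIsotropyLie_eq_one_…` (`(dim 𝔨, dim 𝔭) = (1, 2)`), `IsSimple.hodgeGroup_ne_spGroup_…`
  (`Hg(X) ≠ Sp(V, E)`).
-/

noncomputable section

open scoped Matrix
open Module Matrix NormedSpace NumberField
open Literature.Algebra.Lie
open Literature.RingTheory.CentralSimple (IsAlbertTypeII)
open Literature.NumberTheory.Automorphic (IsZConnected)

namespace Literature.Geometry.Kaehler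

namespace ComplexTorus

/-! ## §1 Engine: the restriction `S → 𝔰𝔩(U)`, `U = e₀₀ V`, is a linear isomorphism -/

section MatrixUnitsDimension

variable {κ : Type*} [Fintype κ] [DecidableEq κ] {R : Type*} [Field R] {e : Fin 2 → Fin 2 → Matrix κ κ R}

/-- A matrix commuting with `P` preserves the image of `P`. [folklore] -/
private theorem mulVec_mem_range_of_comm_dim₄₈ {P Z : Matrix κ κ R} (h : Z * P = P * Z) {u : κ → R}
    (hu : u ∈ LinearMap.range (Matrix.toLin' P)) : Z *ᵥ u ∈ LinearMap.range (Matrix.toLin' P) := by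
  obtain ⟨v, rfl⟩ := hu
  refine ⟨Z *ᵥ v, ?_⟩
  simp only [Matrix.toLin'_apply]
  rw [Matrix.mulVec_mulVec, Matrix.mulVec_mulVec, h]

/-- **THE RESTRICTION TO `U = e₀₀V` IS AN ISOMORPHISM ONTO `𝔰𝔩(U)`, SO `dim S = 3`** (algebraically closed field of
characteristic `0`).  Let `e a b` be a system of `2 × 2` matrix units on `V = R^κ` (`e a b · e c d = δ_{bc} e a d`,
`e₀₀ + e₁₁ = 1`) with `U = e₀₀V` a plane, `E` (Gram matrix `Gc`) invertible and alternating with `e₀₀` `E`-self-adjoint,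
and `S ⊆ M_κ(R)` a subspace closed under `ZW - WZ` whose elements commute with every `e a b`, are `E`-skew, and leave no
subspace of `U` invariant other than `0` and `U`.  Then `dim_R S = 3`: `Z ↦ Z|U` is injective on matrices commuting with
`e₁₀` (`V = U ⊕ e₁₀U`), lands in `𝔰𝔩(U)` (`E|U` non-degenerate, `Z|U` skew), and is onto `𝔰𝔩(U)` by Lie's theorem on
the irreducible plane `U` — «`γ ↦ γ|V_{σ₁}` identifies `U(φ_{1,σ}) ∩ Sp(φ_{2,σ})` with `Sp(φ_{2,σ₁})` […] its standard
representation», `Sp₂ = SL₂`, `dim 𝔰𝔩₂ = 3`. [cite: Milne1999LefschetzClasses, §2 «Simple abelian variety of type II» (p. 650)]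
[cite: MoonenZarhin1999LowDim, §3 proof of (3.3) («`𝔥𝔤(X)_ℂ` acts on each of the summands `U_j^d` through `𝔰𝔩(U_j^d)`»)]
[cite: Humphreys1972, §1.2 (`A_ℓ`, `C_ℓ`) and §4.1 Theorem (Lie)] -/
theorem finrank_eq_three_of_matrixUnits [IsAlgClosed R] [CharZero R]
    (hmul : ∀ a b c d : Fin 2, e a b * e c d = if b = c then e a d else 0) (hone : e 0 0 + e 1 1 = 1)
    {Gc : Matrix κ κ R} (hGc : Gc.det ≠ 0) (hGct : Gcᵀ = -Gc) (hadj : (e 0 0)ᵀ * Gc = Gc * e 0 0)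
    (hdU : finrank R (LinearMap.range (Matrix.toLin' (e 0 0))) = 2)
    (S : Submodule R (Matrix κ κ R)) (hbr : ∀ Z ∈ S, ∀ W ∈ S, Z * W - W * Z ∈ S)
    (hcomm : ∀ Z ∈ S, ∀ a b : Fin 2, Z * e a b = e a b * Z) (hskew : ∀ Z ∈ S, Zᵀ * Gc = -(Gc * Z))
    (hirr : ∀ U' ≤ LinearMap.range (Matrix.toLin' (e 0 0)), (∀ Z ∈ S, ∀ u ∈ U', Z *ᵥ u ∈ U') →
      U' = ⊥ ∨ U' = LinearMap.range (Matrix.toLin' (e 0 0))) :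
    finrank R S = 3 := by
  classical
  set W : Submodule R (κ → R) := LinearMap.range (Matrix.toLin' (e 0 0)) with hWdef
  -- transport `S` to `End(R^κ)` along `Matrix.toLin'`
  set 𝔊 : Submodule R (Module.End R (κ → R)) :=
    S.comap (LinearMap.toMatrix' : Module.End R (κ → R) ≃ₗ[R] Matrix κ κ R).toLinearMap with h𝔊def
  have hmem𝔊 : ∀ Y : Module.End R (κ → R), Y ∈ 𝔊 ↔ LinearMap.toMatrix' Y ∈ S := fun Y ↦ by
    rw [h𝔊def, Submodule.mem_comap, LinearEquiv.coe_coe]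
  have hYv : ∀ (Y : Module.End R (κ → R)) (v : κ → R), Y v = LinearMap.toMatrix' Y *ᵥ v := fun Y v ↦ by
    conv_lhs => rw [← Matrix.toLin'_toMatrix' Y]
    rw [Matrix.toLin'_apply]
  have hfin𝔊 : finrank R 𝔊 = finrank R S :=
    (LinearEquiv.ofSubmodule' (LinearMap.toMatrix' : Module.End R (κ → R) ≃ₗ[R] Matrix κ κ R) S).finrank_eq
  have hbr𝔊 : ∀ Y ∈ 𝔊, ∀ Y' ∈ 𝔊, Y * Y' - Y' * Y ∈ 𝔊 := fun Y hY Y' hY' ↦ by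
    rw [hmem𝔊] at hY hY' ⊢
    rw [map_sub, LinearMap.toMatrix'_mul, LinearMap.toMatrix'_mul]
    exact hbr _ hY _ hY'
  -- `W` is `𝔊`-stable (elements commute with `e₀₀`) and `𝔊`-irreducible
  have hUst : ∀ Y ∈ 𝔊, ∀ u ∈ W, Y u ∈ W := fun Y hY u hu ↦ by
    rw [hYv Y u]
    exact mulVec_mem_range_of_comm_dim₄₈ (hcomm _ ((hmem𝔊 Y).1 hY) 0 0) hu
  have hUirr : ∀ U' ≤ W, (∀ Y ∈ 𝔊, ∀ u ∈ U', Y u ∈ U') → U' = ⊥ ∨ U' = W := by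
    intro U' hU'le hU'st
    refine hirr U' hU'le fun Z hZ u hu ↦ ?_
    have hZ' : Matrix.toLin' Z ∈ 𝔊 := by rw [hmem𝔊, LinearMap.toMatrix'_toLin']; exact hZ
    have h := hU'st _ hZ' u hu
    rwa [Matrix.toLin'_apply] at h
  -- the restriction map `ρ : 𝔊 → End(W)`
  let ρ : 𝔊 →ₗ[R] Module.End R W :=
    { toFun := fun Y ↦ (Y : Module.End R (κ → R)).restrict (hUst Y Y.2)
      map_add' := fun Y Y' ↦ LinearMap.ext fun w ↦ Subtype.ext (by
        simp only [LinearMap.coe_restrict_apply, Submodule.coe_add, LinearMap.add_apply])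
      map_smul' := fun c Y ↦ LinearMap.ext fun w ↦ Subtype.ext (by
        simp only [LinearMap.coe_restrict_apply, Submodule.coe_smul, LinearMap.smul_apply, RingHom.id_apply]) }
  have hρ : ∀ (Y : 𝔊) (w : W), ((ρ Y w : W) : κ → R) = (Y : Module.End R (κ → R)) w := fun _ _ ↦ rfl
  -- `ρ` is injective: elements of `𝔊` commute with `e₁₀` and are determined by their restriction to `W`
  have hc10 : ∀ Y : 𝔊, LinearMap.toMatrix' (Y : Module.End R (κ → R)) * e 1 0 =
      e 1 0 * LinearMap.toMatrix' (Y : Module.End R (κ → R)) := fun Y ↦ hcomm _ ((hmem𝔊 _).1 Y.2) 1 0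
  have hinj : Function.Injective ρ := by
    intro Y Y' hYY'
    apply Subtype.ext
    have hM : LinearMap.toMatrix' (Y : Module.End R (κ → R)) = LinearMap.toMatrix' (Y' : Module.End R (κ → R)) :=
      eq_of_matrixUnits_of_forall_mulVec_eq hmul hone (hc10 Y) (hc10 Y') fun u hu ↦ by
        rw [← hYv, ← hYv]
        have h := congrArg (fun T : Module.End R W ↦ ((T ⟨u, hu⟩ : W) : κ → R)) hYY'
        simpa only [hρ] using h
    exact LinearMap.toMatrix'.injective hM
  -- the image of `ρ` is `𝔰𝔩(W)`
  have hrange : LinearMap.range ρ = LinearMap.ker (LinearMap.trace R W) := by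
    refine le_antisymm ?_ ?_
    · rintro _ ⟨Y, rfl⟩
      rw [LinearMap.mem_ker]
      have hM : LinearMap.toMatrix' (Y : Module.End R (κ → R)) ∈ S := (hmem𝔊 _).1 Y.2
      have hMU : ∀ u ∈ W, Matrix.toLin' (LinearMap.toMatrix' (Y : Module.End R (κ → R))) u ∈ W := fun u hu ↦ by
        rw [Matrix.toLin'_toMatrix']; exact hUst Y Y.2 u hu
      have htr := trace_restrict_eq_zero_of_matrixUnits hmul hone hGc hGct hadj (hskew _ hM) hMU
      have heq : (Matrix.toLin' (LinearMap.toMatrix' (Y : Module.End R (κ → R)))).restrict hMU = ρ Y :=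
        LinearMap.ext fun w ↦ Subtype.ext (by
          rw [LinearMap.coe_restrict_apply, hρ, Matrix.toLin'_toMatrix'])
      rwa [heq] at htr
    · intro T hT
      rw [LinearMap.mem_ker] at hT
      obtain ⟨Y, hY, hYT⟩ := exists_mem_forall_eq_of_trace_eq_zero W hdU 𝔊 hbr𝔊 hUst hUirr hT
      refine ⟨⟨Y, hY⟩, LinearMap.ext fun w ↦ Subtype.ext ?_⟩
      rw [hρ, ← hYT w]
  -- count dimensions: `dim S = dim 𝔊 = dim (range ρ) = dim 𝔰𝔩(W) = 3`
  have hfr := LinearMap.finrank_range_of_inj hinj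
  rw [hrange, finrank_ker_trace_eq_three hdU] at hfr
  rw [← hfin𝔊, ← hfr]

end MatrixUnitsDimension

/-! ## §2 Type II(1): `dim_ℂ 𝔤 = dim_ℂ 𝔩𝔣_ℂ = dim_ℝ 𝔥𝔤_ℝ = dim Hg(X) = 3`, `(dim 𝔨, dim 𝔭) = (1, 2)` -/

section TypeTwoOneDimension

variable {κ : Type} [Fintype κ] [DecidableEq κ] [Nonempty κ] {E : Type} [NormedAddCommGroup E] [NormedSpace ℂ E]
  [FiniteDimensional ℂ E] {Ψ : (κ → ℝ) ≃L[ℝ] E} {η : E [⋀^Fin 2]→L[ℝ] ℝ} {G : Matrix κ κ ℚ}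

/-- **MOONEN–ZARHIN (2.2), TYPE II(1): `dim_ℂ 𝔤 = 3`** for a simple polarised complex abelian surface with quaternion
multiplication (`𝔤 = Lie Hg(X)(ℂ) ≅ 𝔰𝔩₂(ℂ)`, the restriction to the irreducible plane `U = e₀₀V_ℂ` being an
isomorphism onto `𝔰𝔩(U)`): «Then `Hg(X)` is the algebraic group `U_{D^opp}`» — over `ℂ`, `U_{D^opp}(ℂ) ≅ SL₂(ℂ)`.
[cite: MoonenZarhin1999LowDim, §2 (2.2) `g = 2` («Type II(1)») and §3 proof of (3.3)]
[cite: Milne1999LefschetzClasses, §2 «Simple abelian variety of type II» (p. 650)] [cite: Humphreys1972, §1.2 (`dim 𝔰𝔩(ℓ+1, F) = (ℓ+1)² - 1`)] -/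
theorem IsSimple.finrank_hodgeGroupComplexLie_eq_three_of_isAlbertTypeII_of_finrank_eq_two (hX : IsSimple Ψ)
    (hη : IsRiemannForm Ψ η) (hG : G.map (Rat.cast : ℚ → ℝ) = latticeGram Ψ η)
    (h : IsAlbertTypeII (centerField Ψ hX) (endAlgRat Ψ) (rosatiEnd Ψ hη.1 hη.2.2 hG)) (h2 : finrank ℂ E = 2) :
    finrank ℂ (hodgeGroupComplexLie Ψ) = 3 := by
  classical
  obtain ⟨e, hmul, hone, hspan, hgen, hros⟩ := hX.exists_matrixUnits_of_isAlbertTypeII_of_finrank_eq_two hη hG h h2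
  -- the two spellings of `End⁰(X) ⊗ 1`
  have hcast : ∀ A : Matrix κ κ ℚ, A.map ((↑) : ℚ → ℂ) = A.map (algebraMap ℚ ℂ) := fun A ↦
    congrArg A.map (funext fun q ↦ (eq_ratCast (algebraMap ℚ ℂ) q).symm)
  have hset : ((fun A : Matrix κ κ ℚ ↦ A.map ((↑) : ℚ → ℂ)) '' (endAlgRat Ψ : Set (Matrix κ κ ℚ))) =
      (fun A : Matrix κ κ ℚ ↦ A.map (algebraMap ℚ ℂ)) '' (endAlgRat Ψ : Set (Matrix κ κ ℚ)) :=
    Set.image_congr fun A _ ↦ hcast A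
  have hspan' : ∀ a b, e a b ∈ Submodule.span ℂ
      ((fun A : Matrix κ κ ℚ ↦ A.map ((↑) : ℚ → ℂ)) '' (endAlgRat Ψ : Set (Matrix κ κ ℚ))) := fun a b ↦ by
    rw [hset]; exact hspan a b
  -- the Gram matrix: invertible, alternating; `e₀₀` is self-adjoint
  have hGu : IsUnit G.det := isUnit_det_of_map_ratCast hG hη.isUnit_det_latticeGram
  have hGcu : IsUnit (G.map (algebraMap ℚ ℂ)).det := by
    rw [← RingHom.mapMatrix_apply, ← RingHom.map_det]; exact hGu.map _
  have hGt : Gᵀ = -G := transpose_eq_neg_of_map_ratCast Ψ hG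
  have hGct : (G.map (algebraMap ℚ ℂ))ᵀ = -G.map (algebraMap ℚ ℂ) := by
    rw [← Matrix.transpose_map, hGt, Matrix.map_neg _ (map_neg (algebraMap ℚ ℂ))]
  have hadj : (e 0 0)ᵀ * G.map (algebraMap ℚ ℂ) = G.map (algebraMap ℚ ℂ) * e 0 0 := (rosati_eq_iff hGcu _ _).1 (hros 0 0)
  -- the plane `U = e₀₀ V_ℂ`
  have hcardκ : Fintype.card κ = 4 := by rw [card_eq_two_mul_finrank Ψ, h2]
  have hdU : finrank ℂ ↥(LinearMap.range (Matrix.toLin' (e 0 0))) = 2 := by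
    have h2U := two_mul_finrank_range_toLin'_matrixUnits hmul hone
    rw [hcardκ] at h2U
    omega
  -- `𝔤` as a subspace of `M_κ(ℂ)`
  letI : LieRing (Matrix κ κ ℂ) := LieRing.ofAssociativeRing
  change finrank ℂ (hodgeGroupComplexLie Ψ).toSubmodule = 3
  have hmemS : ∀ Z : Matrix κ κ ℂ, Z ∈ (hodgeGroupComplexLie Ψ).toSubmodule ↔ Z ∈ hodgeGroupLieC Ψ := fun Z ↦ by
    rw [LieSubalgebra.mem_toSubmodule, mem_hodgeGroupComplexLie_iff_mem_hodgeGroupLieC]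
  refine finrank_eq_three_of_matrixUnits hmul hone hGcu.ne_zero hGct hadj hdU _ ?_ ?_ ?_ ?_
  · -- closed under the commutator
    intro Z hZ W hW
    rw [hmemS] at hZ hW ⊢
    rw [← Ring.lie_def]
    exact (hodgeGroupLieC Ψ).lie_mem hZ hW
  · -- commutes with `End⁰(X) ⊗ ℂ ∋ e a b`
    intro Z hZ a b
    exact (mul_comm_of_mem_span_endAlgRat_of_mem_hodgeGroupLieC (hspan' a b) ((hmemS Z).1 hZ)).symm
  · -- `E`-skew (`𝔤 ⊆ 𝔩𝔣_ℂ`)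
    intro Z hZ
    exact ((mem_lefschetzLieC_iff Ψ).1 (hη.hodgeGroupLieC_subset_lefschetzLieC hG ((hmemS Z).1 hZ))).1
  · -- `U` is `𝔤`-irreducible: a `𝔤`-stable subspace is the image of an idempotent of `End⁰(X) ⊗ ℂ = span{e a b}`
    intro U' hU'le hU'st
    have hU'st' : ∀ M ∈ hodgeGroupLieC Ψ, ∀ u ∈ U', M *ᵥ u ∈ U' := fun M hM u hu ↦ hU'st M ((hmemS M).2 hM) u hu
    obtain ⟨P, hPspan, hPP, hPU'⟩ := hη.exists_mem_span_endAlgRat_isIdempotentElem_range_eq hU'st'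
    rcases eq_or_ne U' ⊥ with h0 | h0
    · exact Or.inl h0
    refine Or.inr ?_
    have hP0 : P ≠ 0 := by
      rintro rfl
      apply h0
      rw [← hPU', map_zero, LinearMap.range_zero]
    have hPe : P ∈ Submodule.span ℂ (Set.range fun p : Fin 2 × Fin 2 ↦ e p.1 p.2) := by
      have hle : Submodule.span ℂ ((fun A : Matrix κ κ ℚ ↦ A.map ((↑) : ℚ → ℂ)) '' (endAlgRat Ψ : Set (Matrix κ κ ℚ))) ≤
          Submodule.span ℂ (Set.range fun p : Fin 2 × Fin 2 ↦ e p.1 p.2) := by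
        refine Submodule.span_le.2 ?_
        rintro _ ⟨A, hA, rfl⟩
        show A.map ((↑) : ℚ → ℂ) ∈ Submodule.span ℂ (Set.range fun p : Fin 2 × Fin 2 ↦ e p.1 p.2)
        rw [hcast A]
        exact hgen A hA
      exact hle hPspan
    have hle' : LinearMap.range (Matrix.toLin' P) ≤ LinearMap.range (Matrix.toLin' (e 0 0)) := by
      rw [hPU']; exact hU'le
    rw [← hPU']
    exact range_toLin'_eq_of_isIdempotentElem_of_mem_span_matrixUnits hmul hPe hPP hle' hP0

/-- **`dim_ℂ 𝔩𝔣_ℂ = 3`** for a simple surface of Type II(1): `𝔩𝔣_ℂ = Lie S(X)(ℂ) = Lie Sp_D(V,φ)(ℂ) = 𝔤 ≅ 𝔰𝔩₂(ℂ)`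
(g48-#1: `𝔤 = 𝔩𝔣_ℂ`). [cite: Milne1999LefschetzClasses, §2 «Simple abelian variety of type II» (p. 650: «identifies … with `Sp(φ_{2,σ₁})` … its standard representation»)]
[cite: MoonenZarhin1999LowDim, §2 (2.2) `g = 2` («Type II(1)»)] -/
theorem IsSimple.finrank_lefschetzLieC_eq_three_of_isAlbertTypeII_of_finrank_eq_two (hX : IsSimple Ψ)
    (hη : IsRiemannForm Ψ η) (hG : G.map (Rat.cast : ℚ → ℝ) = latticeGram Ψ η)
    (h : IsAlbertTypeII (centerField Ψ hX) (endAlgRat Ψ) (rosatiEnd Ψ hη.1 hη.2.2 hG)) (h2 : finrank ℂ E = 2) :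
    finrank ℂ (lefschetzLieC Ψ G) = 3 := by
  letI : LieRing (Matrix κ κ ℂ) := LieRing.ofAssociativeRing
  have hEq : (hodgeGroupComplexLie Ψ).toSubmodule = (lefschetzLieC Ψ G).toSubmodule := by
    refine Submodule.ext fun Z ↦ ?_
    rw [LieSubalgebra.mem_toSubmodule, LieSubalgebra.mem_toSubmodule, mem_hodgeGroupComplexLie_iff_mem_hodgeGroupLieC,
      ← SetLike.mem_coe, hX.coe_hodgeGroupLieC_eq_lefschetzLieC_of_isAlbertTypeII_of_finrank_eq_two hη hG h h2,
      SetLike.mem_coe]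
  change finrank ℂ (lefschetzLieC Ψ G).toSubmodule = 3
  rw [← hEq]
  exact hX.finrank_hodgeGroupComplexLie_eq_three_of_isAlbertTypeII_of_finrank_eq_two hη hG h h2

/-- **`dim_ℝ 𝔥𝔤_ℝ = 3`** for a simple surface of Type II(1) (`𝔥𝔤_ℝ = Lie U_{D^opp}(ℝ) ≅ 𝔰𝔩₂(ℝ)`; compact form
`SU(2)`, FKRS type **E**). [cite: MoonenZarhin1999LowDim, §2 (2.2) `g = 2` («Type II(1)»)]
[cite: FiteEtAl2012, §4.2 (type **E** `M₂(ℝ)` ↔ `SU(2)`) and §3.2 Lemma 3.7] -/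
theorem IsSimple.finrank_hodgeGroupLie_eq_three_of_isAlbertTypeII_of_finrank_eq_two (hX : IsSimple Ψ)
    (hη : IsRiemannForm Ψ η) (hG : G.map (Rat.cast : ℚ → ℝ) = latticeGram Ψ η)
    (h : IsAlbertTypeII (centerField Ψ hX) (endAlgRat Ψ) (rosatiEnd Ψ hη.1 hη.2.2 hG)) (h2 : finrank ℂ E = 2) :
    finrank ℝ (hodgeGroupLie Ψ) = 3 := by
  rw [← finrank_hodgeGroupComplexLie_eq_finrank_hodgeGroupLie Ψ]
  exact hX.finrank_hodgeGroupComplexLie_eq_three_of_isAlbertTypeII_of_finrank_eq_two hη hG h h2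

/-- **`dim Hg(X) = 3`** for a simple surface of Type II(1) (the trunk's `zdim` of the connected algebraic group
`Hg(X)(ℂ) ≤ GL(V_ℂ)`; `Hg(X) = U_{D^opp}`, a `ℚ`-form of `SL₂`). [cite: MoonenZarhin1999LowDim, §2 (2.2) `g = 2` («Type II(1) … `Hg(X)` is the algebraic group `U_{D^opp}`»)]
[cite: GoodmanWallachGTM255, §1.4.4 Thm. 1.4.10] -/
theorem IsSimple.zdim_hodgeGroupC_eq_three_of_isAlbertTypeII_of_finrank_eq_two (hX : IsSimple Ψ)
    (hη : IsRiemannForm Ψ η) (hG : G.map (Rat.cast : ℚ → ℝ) = latticeGram Ψ η)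
    (h : IsAlbertTypeII (centerField Ψ hX) (endAlgRat Ψ) (rosatiEnd Ψ hη.1 hη.2.2 hG)) (h2 : finrank ℂ E = 2) :
    (isZConnected_map_toGL_hodgeGroupC Ψ).zdim = 3 :=
  (zdim_hodgeGroupC_eq_iff_finrank_hodgeGroupLie_eq Ψ).2
    (hX.finrank_hodgeGroupLie_eq_three_of_isAlbertTypeII_of_finrank_eq_two hη hG h h2)

/-- **`(dim 𝔨, dim 𝔭) = (1, 2)`** for a simple surface of Type II(1): `𝔥𝔤_ℝ ≅ 𝔰𝔩₂(ℝ) = 𝔰𝔬(2) ⊕ 𝔭` (the `SU(2)`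
entry of the six types of abelian surfaces). [cite: FiteEtAl2012, §4.2 (type **E** ↔ `SU(2)`) and §3.2 Lemma 3.7]
[cite: MoonenZarhin1999LowDim, §2 (2.2) `g = 2` («Type II(1)»)] -/
theorem IsSimple.finrank_hodgeIsotropyLie_eq_one_of_isAlbertTypeII_of_finrank_eq_two (hX : IsSimple Ψ)
    (hη : IsRiemannForm Ψ η) (hG : G.map (Rat.cast : ℚ → ℝ) = latticeGram Ψ η)
    (h : IsAlbertTypeII (centerField Ψ hX) (endAlgRat Ψ) (rosatiEnd Ψ hη.1 hη.2.2 hG)) (h2 : finrank ℂ E = 2) :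
    finrank ℝ (hodgeIsotropyLie Ψ) = 1 ∧ finrank ℝ (hodgeCartanP Ψ) = 2 :=
  (hη.finrank_hodgeGroupLie_eq_three_iff_of_finrank_eq_two h2).1
    (hX.finrank_hodgeGroupLie_eq_three_of_isAlbertTypeII_of_finrank_eq_two hη hG h h2)

/-- **`Hg(X) ≠ Sp(V, E)`** for a simple surface of Type II(1) (`dim Hg(X) = 3 < 10 = dim Sp₄`; equivalently `dim 𝔨 = 1 ≠ 4`):
a surface with quaternion multiplication is not a «general» abelian surface. [cite: MoonenZarhin1999LowDim, §2 (2.2) `g = 2` («Type I(1) … `Hg(X) = Sp(V,φ) ≅ Sp_{4,ℚ}`» versus «Type II(1)»)]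
[cite: Lange2023AbelianVarietiesComplex, §7.3.1 Prop. 7.3.2 and Prop. 7.3.3] -/
theorem IsSimple.hodgeGroup_ne_spGroup_of_isAlbertTypeII_of_finrank_eq_two (hX : IsSimple Ψ)
    (hη : IsRiemannForm Ψ η) (hG : G.map (Rat.cast : ℚ → ℝ) = latticeGram Ψ η)
    (h : IsAlbertTypeII (centerField Ψ hX) (endAlgRat Ψ) (rosatiEnd Ψ hη.1 hη.2.2 hG)) (h2 : finrank ℂ E = 2) :
    hodgeGroup Ψ ≠ spGroup Ψ η := fun hsp ↦ by
  have h4 := (hη.finrank_hodgeIsotropyLie_eq_four_iff_of_finrank_eq_two h2).2 hsp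
  have h1 := (hX.finrank_hodgeIsotropyLie_eq_one_of_isAlbertTypeII_of_finrank_eq_two hη hG h h2).1
  omega

end TypeTwoOneDimension

end ComplexTorus

end Literature.Geometry.Kaehler
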